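import Mathlib
import Summits.ResolutionOfSingularities.ResolutionOfSingularities.Theorems.HomologicalConductorPersistenceCyclicTransferSyzygy
import Summits.ResolutionOfSingularities.ResolutionOfSingularities.Theorems.HomologicalConductorNoZenoExtOneExtension
import Literature.RingTheory.CohomologyAnnihilator.StrongGenerator
import Literature.RingTheory.CohomologyAnnihilator.TowerBasic
import Literature.RingTheory.CohomologyAnnihilator.SyzygyDescent
import Summits.ResolutionOfSingularities.ResolutionOfSingularities.Theorems.HomologicalConductorPersistencePeriodicSaturation
import HarnessLib

/-!
# Rung S-2 `PersistenceSurface` (stmt-ResolutionOfSingularities-19970) — the LEVEL LEMMA: duals with vanishing low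
# `Ext` against the ring are HIGH syzygies (`Extⁱ_B(N, B) = 0` for `1 ≤ i ≤ t` ⇒ `N* ∈ Ω^{t+2}`)

Route `ResolutionOfSingularities/HomologicalConductor`, chain W4.4b (cell `res-hironaka`), rung S-2
`PersistenceSurface` (stmt-ResolutionOfSingularities-19970), registered stub
`stub_levelFourPersistenceNonnormalOrNonrational'` (L-other′; class Σ8 = NON-NORMAL stage `0`), cell R5 / S-c.
Seat res-L1-w44b-stub-3 (gen 7) on res-L1-w44b-lead-1's WAVE 2 assignment (STATUS 18:52:55Z «stub-3 → the LEVEL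
LEMMA: Extⁱ_B(C, B) = 0 for 1 ≤ i ≤ s − 2 ⇒ 𝔠 = Hom_B(C,B) is an s-th syzygy ⇒ caˢ⁺¹(B) ⊆ 𝔠»).  This file is the pure
homological algebra; the conductor corollary `caˢ⁺¹(B) ⊆ 𝔠` (via p550697's `exists_linearEquiv_conductor_dual` and
`mem_conductor_of_mem_cohomologyAnnihilatorOfDegree_of_isSyzygy`) is a two-line consequence filed next to p550697.
`[OURS · L1 w44b]`; folklore (Auslander–Bridger: the dual of a module with `Ext^{1..t}(N, B) = 0` is a `(t+2)`-nd
syzygy, read off the dual of a free resolution); NOT a statement of the manuscript under review (Hironaka 2017) and no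
statement of that manuscript is used; AI-written, weaker than expert review.

* `ext_ker_eq_zero_of_forall_ext_succ_eq_zero` — dimension shift: `q : F ↠ N`, `F` projective, `i ≥ 1`:
  `Extⁱ⁺¹(N, L) = 0 ⇒ Extⁱ(ker q, L) = 0`.
* `exists_shortExact_dualMap_of_forall_ext_one_eq_zero` — for `q : F ↠ N` with `Ext¹_B(N, B) = 0` the dual sequence
  `0 → N* → F* → (ker q)* → 0` is SHORT EXACT (Mathlib `range_dualMap_eq_dualAnnihilator_ker_of_surjective` + the tree's
  `dualMap_subtype_surjective_of_forall_ext_one_eq_zero`, W4.4 CA2).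
* `exists_isSyzygy_two_dual'` — base: over a noetherian ring the dual of a finitely generated module is a second syzygy
  (same statement and proof as p550697's `exists_isSyzygy_two_dual`, repeated so that this file does not import the
  conductor files).
* **`exists_isSyzygy_dual_of_forall_ext_eq_zero`** — THE LEVEL LEMMA: `B` noetherian, `N` finitely generated,
  `Extⁱ_B(N, B) = 0` for `1 ≤ i ≤ t` ⇒ `N* = Hom_B(N, B)` is a `(t+2)`-nd syzygy of a finitely generated module
  (induction on `t`: `N* ↪ F* ↠ (ker q)*` and `ker q` inherits the vanishing one degree lower).
* `exists_isSyzygy_three_dual_of_forall_ext_one_eq_zero` — the first case: `Ext¹_B(N, B) = 0 ⇒ N* ∈ Ω³`.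

USE (lead-1): with `N = C|_B` the normalisation of a non-normal stage `B`, `𝔠 ≅ C*` (p550697), so
`Ext¹_B(C, B) = 0 ⇒ ca⁴(B) ⊆ 𝔠` and `Extⁱ_B(C, B) = 0 (1 ≤ i ≤ s−2) ⇒ caˢ⁺¹(B) ⊆ 𝔠`
(`cohomologyAnnihilator_le_conductor_of_forall_isSyzygy` for all levels when all positive `Ext` vanish — e.g. `C`
maximal Cohen–Macaulay over a Gorenstein `B`, on paper).

References (mechanism only): M. Auslander, M. Bridger, *Stable module theory*, Mem. AMS 94 (1969) (k-torsionless
modules; folklore form); S. B. Iyengar, R. Takahashi, IMRN 2016, §2 [`IyengarTakahashi2014`].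
-/

-- single-problem summit: the doubled namespace component `ResolutionOfSingularities` is forced
set_option linter.dupNamespace false

noncomputable section

open CategoryTheory CategoryTheory.Abelian Literature.RingTheory.CohomologyAnnihilator
open Summit.ResolutionOfSingularities.ResolutionOfSingularities.Theorems.NoZeno.SandwichCluster
  (dualMap_subtype_surjective_of_forall_ext_one_eq_zero)
open Summit.ResolutionOfSingularities.ResolutionOfSingularities.Theorems.HomologicalConductor.PersistenceCyclicTransferSyzygy
  (isSyzygy_two_ker)
open Summit.ResolutionOfSingularities.ResolutionOfSingularities.Theorems.HomologicalConductor.PeriodicSaturation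
  (exists_isSyzygy_split)

universe u

namespace Summit.ResolutionOfSingularities.ResolutionOfSingularities.Theorems.HomologicalConductor.PersistenceDualSyzygyLevel

variable {B : Type u} [CommRing B]

/-! ## Dimension shift along a projective cover -/

/-- **Dimension shift.** For `q : F ↠ N` with `F` projective and `i ≥ 1`: if `Extⁱ⁺¹(N, L) = 0` then
`Extⁱ(ker q, L) = 0` (the connecting map `Extⁱ(ker q, L) → Extⁱ⁺¹(N, L)` is injective, its kernel coming from
`Extⁱ(F, L) = 0`). [cite: IyengarTakahashi2014, Remark 2.3] -/
theorem ext_ker_eq_zero_of_forall_ext_succ_eq_zero {F N : Type u} [AddCommGroup F] [Module B F]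
    [Module.Projective B F] [AddCommGroup N] [Module B N] {q : F →ₗ[B] N} (hq : Function.Surjective q)
    (L : ModuleCat.{u} B) {i : ℕ} (hi : 1 ≤ i)
    (h : ∀ e' : Ext.{u} (ModuleCat.of B N) L (i + 1), e' = 0)
    (e : Ext.{u} (ModuleCat.of B (LinearMap.ker q)) L i) : e = 0 := by
  have hS := LinearMap.shortExact_shortComplexKer hq
  have hδ : hS.extClass.comp e (add_comm 1 i) = 0 := h _
  obtain ⟨x₂, hx₂⟩ := Ext.contravariant_sequence_exact₁ hS L e (add_comm 1 i) hδ
  obtain ⟨j, rfl⟩ : ∃ j, i = j + 1 := ⟨i - 1, by omega⟩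
  haveI : Projective (LinearMap.shortComplexKer q).X₂ := by
    change Projective (ModuleCat.of B F)
    infer_instance
  rw [← hx₂, Ext.eq_zero_of_projective x₂, Ext.comp_zero]

/-! ## The dual of `0 → ker q → F → N → 0` is short exact when `Ext¹(N, B) = 0` -/

/-- **Dualising a projective cover.** For `q : F ↠ N` (`F`, `N` any modules) with `Ext¹_B(N, B) = 0`, the sequence
`0 → N* —q*→ F* —res→ (ker q)* → 0` is short exact: `q*` is injective (`q` onto), `range q* = (ker q)⊥ = ker res`
(Mathlib), and `res` is onto (tree `dualMap_subtype_surjective_of_forall_ext_one_eq_zero`). [folklore] -/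
theorem exists_shortExact_dualMap_of_forall_ext_one_eq_zero {F N : Type u} [AddCommGroup F] [Module B F]
    [AddCommGroup N] [Module B N] {q : F →ₗ[B] N} (hq : Function.Surjective q)
    (h1 : ∀ e : Ext.{u} (ModuleCat.of B N) (ModuleCat.of B B) 1, e = 0) :
    ∃ w : ModuleCat.ofHom q.dualMap ≫ ModuleCat.ofHom (LinearMap.ker q).subtype.dualMap = 0,
      (ShortComplex.mk (ModuleCat.ofHom (X := ModuleCat.of B (Module.Dual B N))
        (Y := ModuleCat.of B (Module.Dual B F)) q.dualMap)
        (ModuleCat.ofHom (X := ModuleCat.of B (Module.Dual B F))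
          (Y := ModuleCat.of B (Module.Dual B (LinearMap.ker q))) (LinearMap.ker q).subtype.dualMap) w).ShortExact := by
  have hexact : Function.Exact q.dualMap (LinearMap.ker q).subtype.dualMap := by
    rw [LinearMap.exact_iff, LinearMap.ker_dualMap_eq_dualAnnihilator_range, Submodule.range_subtype,
      LinearMap.range_dualMap_eq_dualAnnihilator_ker_of_surjective q hq]
  exact exists_shortExact_of_linearMap (Y := ModuleCat.of B (Module.Dual B N))
    (M := ModuleCat.of B (Module.Dual B F)) (X := ModuleCat.of B (Module.Dual B (LinearMap.ker q)))
    q.dualMap (LinearMap.ker q).subtype.dualMap (LinearMap.dualMap_injective_of_surjective hq)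
    (dualMap_subtype_surjective_of_forall_ext_one_eq_zero hq h1) hexact

/-! ## Base: duals are second syzygies -/

/-- **Over a noetherian ring the dual of a finitely generated module is a second syzygy** (same statement and proof
as p550697's `exists_isSyzygy_two_dual`: `N* ≅ range π* = ker ρ*` for a finite presentation `Bᵐ —ρ→ Bⁿ —π→ N → 0`,
tree `isSyzygy_two_ker`). [folklore] -/
theorem exists_isSyzygy_two_dual' [IsNoetherianRing B] (N : Type u) [AddCommGroup N] [Module B N]
    [Module.Finite B N] :
    ∃ (X : ModuleCat.{u} B), Module.Finite B X ∧ IsSyzygy 2 X (ModuleCat.of B (Module.Dual B N)) := by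
  obtain ⟨n, π, hπ⟩ := Module.Finite.exists_fin' B N
  haveI : Module.Finite B (LinearMap.ker π) := Module.IsNoetherian.finite B _
  obtain ⟨m, ρ₀, hρ₀⟩ := Module.Finite.exists_fin' B (LinearMap.ker π)
  let ρ : (Fin m → B) →ₗ[B] (Fin n → B) := (LinearMap.ker π).subtype ∘ₗ ρ₀
  have hrange : LinearMap.range ρ = LinearMap.ker π := by
    rw [LinearMap.range_comp, LinearMap.range_eq_top.mpr hρ₀, Submodule.map_top, Submodule.range_subtype]
  have hker : LinearMap.range π.dualMap = LinearMap.ker ρ.dualMap := by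
    rw [LinearMap.ker_dualMap_eq_dualAnnihilator_range, hrange,
      LinearMap.range_dualMap_eq_dualAnnihilator_ker_of_surjective π hπ]
  let e : Module.Dual B N ≃ₗ[B] LinearMap.ker ρ.dualMap :=
    (LinearEquiv.ofInjective π.dualMap (LinearMap.dualMap_injective_of_surjective hπ)).trans
      (LinearEquiv.ofEq _ _ hker)
  refine ⟨ModuleCat.of B (Module.Dual B (Fin m → B) ⧸ LinearMap.range ρ.dualMap), inferInstance, ?_⟩
  exact (isSyzygy_two_ker ρ.dualMap).of_iso e.symm.toModuleIso

/-! ## The level lemma -/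

/-- **THE LEVEL LEMMA (Auslander–Bridger).**  Over a noetherian ring `B`, if a finitely generated module `N` has
`Extⁱ_B(N, B) = 0` for `1 ≤ i ≤ t`, then its dual `N* = Hom_B(N, B)` is a `(t+2)`-nd syzygy of a finitely generated
module.  Induction on `t`: for a cover `q : Bⁿ ↠ N`, `0 → N* → (Bⁿ)* → (ker q)* → 0` is short exact
(`Ext¹(N, B) = 0`) and `ker q` has `Extⁱ(ker q, B) = Extⁱ⁺¹(N, B) = 0` for `1 ≤ i ≤ t − 1`. [folklore] -/
theorem exists_isSyzygy_dual_of_forall_ext_eq_zero [IsNoetherianRing B] :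
    ∀ (t : ℕ) (N : Type u) [AddCommGroup N] [Module B N], Module.Finite B N →
      (∀ i : ℕ, 1 ≤ i → i ≤ t → ∀ e : Ext.{u} (ModuleCat.of B N) (ModuleCat.of B B) i, e = 0) →
      ∃ (X : ModuleCat.{u} B), Module.Finite B X ∧ IsSyzygy (t + 2) X (ModuleCat.of B (Module.Dual B N)) := by
  intro t
  induction t with
  | zero =>
    intro N _ _ hN _
    haveI := hN
    exact exists_isSyzygy_two_dual' N
  | succ t ih =>
    intro N _ _ hN hExt
    haveI := hN
    obtain ⟨n, q, hq⟩ := Module.Finite.exists_fin' B N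
    haveI : Module.Finite B (LinearMap.ker q) := Module.IsNoetherian.finite B _
    -- `ker q` inherits the vanishing one degree lower
    have hK : ∀ i : ℕ, 1 ≤ i → i ≤ t →
        ∀ e : Ext.{u} (ModuleCat.of B (LinearMap.ker q)) (ModuleCat.of B B) i, e = 0 :=
      fun i hi hit e => ext_ker_eq_zero_of_forall_ext_succ_eq_zero hq (ModuleCat.of B B) hi
        (fun e' => hExt (i + 1) (by omega) (by omega) e') e
    obtain ⟨X, hX, hIH⟩ := ih (LinearMap.ker q) inferInstance hK
    obtain ⟨w, hS⟩ := exists_shortExact_dualMap_of_forall_ext_one_eq_zero hq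
      (fun e => hExt 1 le_rfl (by omega) e)
    refine ⟨X, hX, ?_⟩
    show IsSyzygy ((t + 2) + 1) X (ModuleCat.of B (Module.Dual B N))
    exact ⟨ModuleCat.of B (Module.Dual B (LinearMap.ker q)), ModuleCat.of B (Module.Dual B (Fin n → B)), hIH,
      inferInstance, (IsProjective.iff_projective (R := B) (Module.Dual B (Fin n → B))).mp inferInstance,
      _, _, w, hS⟩

/-- **First case: `Ext¹_B(N, B) = 0 ⇒ N* ∈ Ω³`.**  (With `N = C` the normalisation of a non-normal stage `B` and
`𝔠 ≅ C*`: `ca⁴(B) ⊆ 𝔠`, p550697's `mem_conductor_of_mem_cohomologyAnnihilatorOfDegree_of_isSyzygy`.) [folklore] -/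
theorem exists_isSyzygy_three_dual_of_forall_ext_one_eq_zero [IsNoetherianRing B] (N : Type u) [AddCommGroup N]
    [Module B N] [Module.Finite B N] (h1 : ∀ e : Ext.{u} (ModuleCat.of B N) (ModuleCat.of B B) 1, e = 0) :
    ∃ (X : ModuleCat.{u} B), Module.Finite B X ∧ IsSyzygy 3 X (ModuleCat.of B (Module.Dual B N)) :=
  exists_isSyzygy_dual_of_forall_ext_eq_zero 1 N inferInstance fun i hi hi1 e => by
    obtain rfl : i = 1 := le_antisymm hi1 hi
    exact h1 e

/-- **All levels: `Extⁱ_B(N, B) = 0` for every `i ≥ 1` ⇒ `N*` is an `s`-th syzygy for every `s`** (the hypothesis of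
p550697's `cohomologyAnnihilator_le_conductor_of_forall_isSyzygy` for `N* ≅ 𝔠`; e.g. `N` maximal Cohen–Macaulay over a
Gorenstein `B`, on paper). [folklore] -/
theorem exists_isSyzygy_dual_of_forall_ext_eq_zero' [IsNoetherianRing B] (N : Type u) [AddCommGroup N]
    [Module B N] [Module.Finite B N]
    (h : ∀ i : ℕ, 1 ≤ i → ∀ e : Ext.{u} (ModuleCat.of B N) (ModuleCat.of B B) i, e = 0) (s : ℕ) :
    ∃ (X : ModuleCat.{u} B), Module.Finite B X ∧ IsSyzygy s X (ModuleCat.of B (Module.Dual B N)) := by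
  -- an `(s+2)`-nd syzygy is an `s`-th syzygy of a (finitely generated) second syzygy
  obtain ⟨X, hX, h2⟩ := exists_isSyzygy_dual_of_forall_ext_eq_zero s N inferInstance
    fun i hi _ e => h i hi e
  haveI := hX
  obtain ⟨M', hM', hs⟩ := exists_isSyzygy_split (T := B) 2 (b := s) h2
  exact ⟨M', finite_of_isSyzygy 2 hX hM', hs⟩

end Summit.ResolutionOfSingularities.ResolutionOfSingularities.Theorems.HomologicalConductor.PersistenceDualSyzygyLevel

end
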